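import Summits.RiemannHypothesis.RiemannHypothesis.Theorems.SemilocalNegCertSixtyOneKinked2107
import HarnessLib

/-!
# Semi-local threshold of the `{∞,2,…,61}` form, negative side: `a*({2,…,61}) ≤ 1079 / 512 = 2.107421875` — the wall `q = 67` from a KINKED (piecewise-cubic) witness with slope breaks at the prime-atom images (part 19/25: the kernel facts piece 267 … piece 281 of 340 (imports part 1 only))

Cell `rh-explicit` (HOME `run/shared/lean/pub/rh-explicit/`), seat cc-s2-9 gen3 (HUMAN RULING D-0074 (D5) WEIL data engine; LADDER-RH column WEIL, rung DATA → W-P(P2);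
pipeline = cc-s2-4 gen8/gen11's piecewise-witness layer `SemilocalPiecewise{Witness,Increment,IncrementSum,Cert}.lean` + their float finder, every number
re-derived by an independent second engine E2 before filing; gen0/gen2 rows: `SemilocalNegCert{ThirteenKinked1423,…,FiftyThreeKinked2044}*`, capstone `SemilocalKinkedWallOffsets`).
HONEST FRAMING: RH-FREE theorems about the tree's `weilSemilocalThreshold S` of a TRUNCATED Weil form (finitely many places); nothing here bears on the
truth of RH; the lower clause `(log q)/2 ≤ a*(S_q)` at all primes IS RH and is untouched; the SIGN of `δ*(67)` is not claimed.

KINKED row for the wall `q = 67` (`S = {2,…,61}`): at `b = 1079 / 512 = 2.107421875 ≈ a*(S_67) + 0.0050` (DATA, two engines, cc-s2-6/cc-s2-3: `a*(S_67) = 2.1023719`)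
the polynomial × indicator class is far from negative (tree row `545/256`, `SemilocalNegCertUptoSixtyOneFinal`, `δ*(67) ≤ 0.0266`), whereas an odd piecewise cubic with slope breaks at the images
`|b − log n|` (rounded to `/1024`) of the atoms `n ∈ {3,5,7,11,13,17,19,23,29,31,37,41,43,47,53,59,61}` (the odd-prime atoms; all atom images resp. all primes resp. primes + 4 + 9 scanned, kit j257393) is negative by `4.308e-03·‖G‖²`.
Instance: `S = {2, 3, 5, 7, 11, 13, 17, 19, 23, 29, 31, 37, 41, 43, 47, 53, 59, 61}`, `N = 70` (atom table `atomsUptoSixtyOne` / `atomsEnclose_UptoSixtyOne` of `SemilocalNegCertUptoSixtyOne.lean`), 18 pieces of degree ≤ 3, 340 `t`-pieces;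
TWO ENGINES on the witness before the kernel: cc-s2-4's float finder `λ_min = -4.3083e-03` and the seat's exact-in-`x` decimal engine E2 `R = -4.3190e-03` (no polar credit);
the exact kernel margin is the certificate's own rational arithmetic (farm report).  ⇒ **`a*({2,…,61}) ≤ 1079 / 512`, `δ*(67) < 0.005076`** (was `0.0266`).
No data is trusted: every bound is a `decide +kernel` fact.  Folklore throughout.
-/

set_option autoImplicit false
set_option linter.dupNamespace false  -- the mandated namespace repeats `RiemannHypothesis`
set_option Elab.async false  -- serialise the kernel facts: in parallel they exhaust the node's per-process heap (cc-s2-4 gen11, CC4-LEAN §16.10)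

noncomputable section

open Complex Filter Set MeasureTheory Topology
open scoped Real

namespace Summit.RiemannHypothesis.RiemannHypothesis.Theorems.SemilocalPolyWitness

open MeasureTheory Set Finset Real
open Literature.NumberTheory.LFunctions
open Summit.RiemannHypothesis.RiemannHypothesis.Theorems.MotivicDoor
open Summit.RiemannHypothesis.RiemannHypothesis.Theorems.MotivicDoor.SemilocalThreshold
open Summit.RiemannHypothesis.RiemannHypothesis.Theorems.MotivicDoor.SemilocalMarkov
open LQ

set_option maxHeartbeats 0 in
/-- kernel fact: piece `267` of `certSixtyOneKinked2107`. -/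
theorem check_SixtyOneKinked2107_piece267 : certSixtyOneKinked2107.checkPiecePW 267 = true := by
  decide +kernel

set_option maxHeartbeats 0 in
/-- kernel fact: piece `268` of `certSixtyOneKinked2107`. -/
theorem check_SixtyOneKinked2107_piece268 : certSixtyOneKinked2107.checkPiecePW 268 = true := by
  decide +kernel

set_option maxHeartbeats 0 in
/-- kernel fact: piece `269` of `certSixtyOneKinked2107`. -/
theorem check_SixtyOneKinked2107_piece269 : certSixtyOneKinked2107.checkPiecePW 269 = true := by
  decide +kernel

set_option maxHeartbeats 0 in
/-- kernel fact: piece `270` of `certSixtyOneKinked2107`. -/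
theorem check_SixtyOneKinked2107_piece270 : certSixtyOneKinked2107.checkPiecePW 270 = true := by
  decide +kernel

set_option maxHeartbeats 0 in
/-- kernel fact: piece `271` of `certSixtyOneKinked2107`. -/
theorem check_SixtyOneKinked2107_piece271 : certSixtyOneKinked2107.checkPiecePW 271 = true := by
  decide +kernel

set_option maxHeartbeats 0 in
/-- kernel fact: piece `272` of `certSixtyOneKinked2107`. -/
theorem check_SixtyOneKinked2107_piece272 : certSixtyOneKinked2107.checkPiecePW 272 = true := by
  decide +kernel

set_option maxHeartbeats 0 in
/-- kernel fact: piece `273` of `certSixtyOneKinked2107`. -/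
theorem check_SixtyOneKinked2107_piece273 : certSixtyOneKinked2107.checkPiecePW 273 = true := by
  decide +kernel

set_option maxHeartbeats 0 in
/-- kernel fact: piece `274` of `certSixtyOneKinked2107`. -/
theorem check_SixtyOneKinked2107_piece274 : certSixtyOneKinked2107.checkPiecePW 274 = true := by
  decide +kernel

set_option maxHeartbeats 0 in
/-- kernel fact: piece `275` of `certSixtyOneKinked2107`. -/
theorem check_SixtyOneKinked2107_piece275 : certSixtyOneKinked2107.checkPiecePW 275 = true := by
  decide +kernel

set_option maxHeartbeats 0 in
/-- kernel fact: piece `276` of `certSixtyOneKinked2107`. -/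
theorem check_SixtyOneKinked2107_piece276 : certSixtyOneKinked2107.checkPiecePW 276 = true := by
  decide +kernel

set_option maxHeartbeats 0 in
/-- kernel fact: piece `277` of `certSixtyOneKinked2107`. -/
theorem check_SixtyOneKinked2107_piece277 : certSixtyOneKinked2107.checkPiecePW 277 = true := by
  decide +kernel

set_option maxHeartbeats 0 in
/-- kernel fact: piece `278` of `certSixtyOneKinked2107`. -/
theorem check_SixtyOneKinked2107_piece278 : certSixtyOneKinked2107.checkPiecePW 278 = true := by
  decide +kernel

set_option maxHeartbeats 0 in
/-- kernel fact: piece `279` of `certSixtyOneKinked2107`. -/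
theorem check_SixtyOneKinked2107_piece279 : certSixtyOneKinked2107.checkPiecePW 279 = true := by
  decide +kernel

set_option maxHeartbeats 0 in
/-- kernel fact: piece `280` of `certSixtyOneKinked2107`. -/
theorem check_SixtyOneKinked2107_piece280 : certSixtyOneKinked2107.checkPiecePW 280 = true := by
  decide +kernel

set_option maxHeartbeats 0 in
/-- kernel fact: piece `281` of `certSixtyOneKinked2107`. -/
theorem check_SixtyOneKinked2107_piece281 : certSixtyOneKinked2107.checkPiecePW 281 = true := by
  decide +kernel

end Summit.RiemannHypothesis.RiemannHypothesis.Theorems.SemilocalPolyWitness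

end
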